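import Summits.NavierStokesRegularity.FunctionalMining.PlanarShadowRates
import HarnessLib

/-!
# FunctionalMining — PLANAR SHADOW IN THE KERNEL (part 4): nine K0 rows of columns C3a / C3b are
# FALSE for every constant

Search for candidate a priori estimates; no regularity claim. Cell `pub-nsfunc`, prove seat
(gen 18). Refutations of CANDIDATE a priori inequalities (conditional rate shapes along classical
solutions on `T³`); nothing about regularity or blow-up is asserted.

THE MECHANISM (SIEVEK §1 Lemma 0 / Lemma 1″, "planar shadow"; K0-FLAGS A1/A7/A11). A row of shape
`T_C` with multiplier `‖λ₂⁺(S)‖_∞` (column C3b) or `‖α⁺‖_∞` (column C3a) contains, at every PLANAR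
datum (where both multipliers vanish identically), the statement "the inertial (Euler) rate of the
functional is `≤ 0`" (`PlanarShadowDoor`: local existence, the row at the initial time with
multiplier `0`, `ν → 0⁺`). The planar witness `w` of `PlanarShadowWitness` has `λ₂(S) ≡ 0`, `σ ≡ 0`
and POSITIVE inertial rates of `∫|S|⁴`, `∫π²`, `∫|∇π|²`, `∫|Π^dev|²` (`PlanarShadowRates`, exact
values `(2/5)(2π)⁵`, `(49/50)2π`, `(9/5)(2π)³`, `(44/15)(2π)⁵` from the Fourier tables by `decide`).
Hence, for EVERY constant `C` (and every `c`, `j` in the logarithmic shape):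

| K0 row | typed statement refuted here |
|---|---|
| `ES.absS.q=4 \| T_C \| C3b` | `StrainMomentMidEigRateBound 4 C` |
| `ES.absS.q=4 \| T_C \| C3a` | `StrainMomentStretchRateBound 4 C` |
| `ES.absS.q=4 \| T_CL \| C3a \| j` | `StrainMomentStretchLogBudget 4 j C c` |
| `EP.p.q=2 \| T_C \| C3b / C3a` | `PressureMomentMidEigRateBound 2 C` / `PressureMomentStretchRateBound 2 C` |
| `EP.gradp.q=2 \| T_C \| C3b / C3a` | `GradPressureMomentMidEigRateBound 2 C` / `GradPressureMomentStretchRateBound 2 C` |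
| `EP.Pidev.q=2 \| T_C \| C3b / C3a` | `PidevMomentMidEigRateBound 2 C` / `PidevMomentStretchRateBound 2 C` |

(verdicts of record, nogo `sievek/verdicts.json` / `verdicts_C3a.json`: DEAD ∀C by the numerical
witnesses `±P2Db`, `−P2D`, `+P2Db`; this file is the kernel form, with ONE planar witness for all nine.)
The doors are generic: every further functional with a `HasInitialRate` package and every further
trigonometric witness enter the same two lemmas.
-/

noncomputable section

open MeasureTheory

namespace Summit.NavierStokesRegularity.FunctionalMining

open Literature.Analysis Literature.Analysis.FunctionSpaces Literature.Analysis.FunctionSpaces.Torus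
  Literature.Analysis.FluidPDE

variable {d : Type*} [Fintype d] [DecidableEq d]

/-! ## 1. The nine rows as named statements -/

/-- K0 row **`ES.absS.q|T_C|C3b`**: `d/dt∫|S|^q ≤ C‖λ₂⁺‖_∞∫|S|^q`. Search for candidate a priori
estimates; no regularity claim — nothing is asserted. [ours; typed K0 row] -/
@[conjecture] def StrainMomentMidEigRateBound (q C : ℝ) : Prop :=
  FunctionalMidEigRateBound (d := d) (torusStrainMoment q) C

/-- K0 row **`ES.absS.q|T_C|C3a`**: `d/dt∫|S|^q ≤ C‖α⁺‖_∞∫|S|^q`. [ours; typed K0 row] -/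
@[conjecture] def StrainMomentStretchRateBound (q C : ℝ) : Prop :=
  FunctionalStretchRateBound (d := d) (torusStrainMoment q) C

/-- K0 row **`ES.absS.q|T_CL|C3a|j`**: `d/dt∫|S|^q ≤ C‖α⁺‖_∞∫|S|^q log^j(e + c∫|S|^q/ν^q)`.
[ours; typed K0 row] -/
@[conjecture] def StrainMomentStretchLogBudget (q : ℝ) (j : ℕ) (C c : ℝ) : Prop :=
  FunctionalStretchLogBudget (d := d) (torusStrainMoment q) q j C c

/-- K0 row **`EP.p.q|T_C|C3b`**: `d/dt∫|π|^q ≤ C‖λ₂⁺‖_∞∫|π|^q`. [ours; typed K0 row] -/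
@[conjecture] def PressureMomentMidEigRateBound (q C : ℝ) : Prop :=
  FunctionalMidEigRateBound (d := d) (torusPressureMoment q) C

/-- K0 row **`EP.p.q|T_C|C3a`**: `d/dt∫|π|^q ≤ C‖α⁺‖_∞∫|π|^q`. [ours; typed K0 row] -/
@[conjecture] def PressureMomentStretchRateBound (q C : ℝ) : Prop :=
  FunctionalStretchRateBound (d := d) (torusPressureMoment q) C

/-- K0 row **`EP.gradp.q|T_C|C3b`**: `d/dt∫|∇π|^q ≤ C‖λ₂⁺‖_∞∫|∇π|^q`. [ours; typed K0 row] -/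
@[conjecture] def GradPressureMomentMidEigRateBound (q C : ℝ) : Prop :=
  FunctionalMidEigRateBound (d := d) (torusGradPressureMoment q) C

/-- K0 row **`EP.gradp.q|T_C|C3a`**: `d/dt∫|∇π|^q ≤ C‖α⁺‖_∞∫|∇π|^q`. [ours; typed K0 row] -/
@[conjecture] def GradPressureMomentStretchRateBound (q C : ℝ) : Prop :=
  FunctionalStretchRateBound (d := d) (torusGradPressureMoment q) C

/-- K0 row **`EP.Pidev.q|T_C|C3b`**: `d/dt∫|Π^dev|^q ≤ C‖λ₂⁺‖_∞∫|Π^dev|^q`. [ours; typed K0 row] -/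
@[conjecture] def PidevMomentMidEigRateBound (q C : ℝ) : Prop :=
  FunctionalMidEigRateBound (d := d) (torusPidevMoment q) C

/-- K0 row **`EP.Pidev.q|T_C|C3a`**: `d/dt∫|Π^dev|^q ≤ C‖α⁺‖_∞∫|Π^dev|^q`. [ours; typed K0 row] -/
@[conjecture] def PidevMomentStretchRateBound (q C : ℝ) : Prop :=
  FunctionalStretchRateBound (d := d) (torusPidevMoment q) C

/-! ## 2. The kills on the unit 3-torus `(ℝ/ℤ)³` -/

namespace PlanarShadow

open TrigPolyExact

/-- **`ES.absS.q=4 | T_C | C3b` is FALSE for every `C`.** [ours] -/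
theorem not_strainMomentMidEigRateBound_four (C : ℝ) :
    ¬ StrainMomentMidEigRateBound (d := Fin 3) 4 C := fun hB =>
  absurd (FunctionalMidEigRateBound.inertialRate_nonpos hB (hasInitialRate_torusStrainMoment (by norm_num))
      (Fintype.card_fin 3) isSmooth_w isDivFree_w hasZeroMean_w middle_w_nonpos)
    (not_le.mpr strainMomentInertialRate_four_w_pos)

/-- **`ES.absS.q=4 | T_C | C3a` is FALSE for every `C`.** [ours] -/
theorem not_strainMomentStretchRateBound_four (C : ℝ) :
    ¬ StrainMomentStretchRateBound (d := Fin 3) 4 C := fun hB =>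
  absurd (FunctionalStretchRateBound.inertialRate_nonpos hB (hasInitialRate_torusStrainMoment (by norm_num))
      (Fintype.card_fin 3) isSmooth_w isDivFree_w hasZeroMean_w stretchingDensity_w_nonpos)
    (not_le.mpr strainMomentInertialRate_four_w_pos)

/-- **`ES.absS.q=4 | T_CL | C3a | j` is FALSE for every `C`, `c`, `j`.** [ours] -/
theorem not_strainMomentStretchLogBudget_four (j : ℕ) (C c : ℝ) :
    ¬ StrainMomentStretchLogBudget (d := Fin 3) 4 j C c := fun hB =>
  absurd (FunctionalStretchLogBudget.inertialRate_nonpos hB (hasInitialRate_torusStrainMoment (by norm_num))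
      (Fintype.card_fin 3) isSmooth_w isDivFree_w hasZeroMean_w stretchingDensity_w_nonpos)
    (not_le.mpr strainMomentInertialRate_four_w_pos)

/-- **`EP.p.q=2 | T_C | C3b` is FALSE for every `C`.** [ours] -/
theorem not_pressureMomentMidEigRateBound_two (C : ℝ) :
    ¬ PressureMomentMidEigRateBound (d := Fin 3) 2 C := fun hB =>
  absurd (FunctionalMidEigRateBound.inertialRate_nonpos hB hasInitialRate_torusPressureMoment_two
      (Fintype.card_fin 3) isSmooth_w isDivFree_w hasZeroMean_w middle_w_nonpos)
    (not_le.mpr pressureSqInertialRate_w_pos)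

/-- **`EP.p.q=2 | T_C | C3a` is FALSE for every `C`.** [ours] -/
theorem not_pressureMomentStretchRateBound_two (C : ℝ) :
    ¬ PressureMomentStretchRateBound (d := Fin 3) 2 C := fun hB =>
  absurd (FunctionalStretchRateBound.inertialRate_nonpos hB hasInitialRate_torusPressureMoment_two
      (Fintype.card_fin 3) isSmooth_w isDivFree_w hasZeroMean_w stretchingDensity_w_nonpos)
    (not_le.mpr pressureSqInertialRate_w_pos)

/-- **`EP.gradp.q=2 | T_C | C3b` is FALSE for every `C`.** [ours] -/
theorem not_gradPressureMomentMidEigRateBound_two (C : ℝ) :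
    ¬ GradPressureMomentMidEigRateBound (d := Fin 3) 2 C := fun hB =>
  absurd (FunctionalMidEigRateBound.inertialRate_nonpos hB hasInitialRate_torusGradPressureMoment_two
      (Fintype.card_fin 3) isSmooth_w isDivFree_w hasZeroMean_w middle_w_nonpos)
    (not_le.mpr gradPressureSqInertialRate_w_pos)

/-- **`EP.gradp.q=2 | T_C | C3a` is FALSE for every `C`.** [ours] -/
theorem not_gradPressureMomentStretchRateBound_two (C : ℝ) :
    ¬ GradPressureMomentStretchRateBound (d := Fin 3) 2 C := fun hB =>
  absurd (FunctionalStretchRateBound.inertialRate_nonpos hB hasInitialRate_torusGradPressureMoment_two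
      (Fintype.card_fin 3) isSmooth_w isDivFree_w hasZeroMean_w stretchingDensity_w_nonpos)
    (not_le.mpr gradPressureSqInertialRate_w_pos)

/-- **`EP.Pidev.q=2 | T_C | C3b` is FALSE for every `C`.** [ours] -/
theorem not_pidevMomentMidEigRateBound_two (C : ℝ) :
    ¬ PidevMomentMidEigRateBound (d := Fin 3) 2 C := fun hB =>
  absurd (FunctionalMidEigRateBound.inertialRate_nonpos hB hasInitialRate_torusPidevMoment_two
      (Fintype.card_fin 3) isSmooth_w isDivFree_w hasZeroMean_w middle_w_nonpos)
    (not_le.mpr pidevSqInertialRate_w_pos)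

/-- **`EP.Pidev.q=2 | T_C | C3a` is FALSE for every `C`.** [ours] -/
theorem not_pidevMomentStretchRateBound_two (C : ℝ) :
    ¬ PidevMomentStretchRateBound (d := Fin 3) 2 C := fun hB =>
  absurd (FunctionalStretchRateBound.inertialRate_nonpos hB hasInitialRate_torusPidevMoment_two
      (Fintype.card_fin 3) isSmooth_w isDivFree_w hasZeroMean_w stretchingDensity_w_nonpos)
    (not_le.mpr pidevSqInertialRate_w_pos)

/-! ## 3. The kills in the generic shapes (no constant works, all nine rows) -/

/-- Summary: on `(ℝ/ℤ)³` no constant makes any of the nine rows true. [ours] -/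
theorem planarShadow_killAll (C : ℝ) :
    ¬ FunctionalMidEigRateBound (d := Fin 3) (torusStrainMoment 4) C ∧
    ¬ FunctionalStretchRateBound (d := Fin 3) (torusStrainMoment 4) C ∧
    ¬ FunctionalMidEigRateBound (d := Fin 3) (torusPressureMoment 2) C ∧
    ¬ FunctionalStretchRateBound (d := Fin 3) (torusPressureMoment 2) C ∧
    ¬ FunctionalMidEigRateBound (d := Fin 3) (torusGradPressureMoment 2) C ∧
    ¬ FunctionalStretchRateBound (d := Fin 3) (torusGradPressureMoment 2) C ∧
    ¬ FunctionalMidEigRateBound (d := Fin 3) (torusPidevMoment 2) C ∧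
    ¬ FunctionalStretchRateBound (d := Fin 3) (torusPidevMoment 2) C :=
  ⟨not_strainMomentMidEigRateBound_four C, not_strainMomentStretchRateBound_four C,
    not_pressureMomentMidEigRateBound_two C, not_pressureMomentStretchRateBound_two C,
    not_gradPressureMomentMidEigRateBound_two C, not_gradPressureMomentStretchRateBound_two C,
    not_pidevMomentMidEigRateBound_two C, not_pidevMomentStretchRateBound_two C⟩

end PlanarShadow

end Summit.NavierStokesRegularity.FunctionalMining

end
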